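import Literature.AlgebraicGeometry.Motives.CartierDivisorExtension
import HarnessLib

/-!
# Ample Cartier divisors: extension of sections and eventual generation (Görtz–Wedhorn I, Thm. 7.22,
# Prop. 13.47)

For a Cartier divisor `D = (U i, f i)` on an integral scheme `X` (`Motives/CartierDivisor`, the
concrete model `Γ(X, 𝒪_X(D)) ⊆ K(X)`), ampleness is recorded there in the form of Görtz–Wedhorn I,
Prop. 13.47 (iv) (`CartierDivisor.IsAmple`: `X` qcqs and for some `d ≥ 1` every point lies in an
affine non-vanishing locus `X_s`, `s ∈ Γ(X, 𝒪_X(d • D))`). This file proves the implication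
(iv) ⇒ (i) of Prop. 13.47 for the line bundles `𝓕 = 𝒪_X(j • D)` themselves, i.e. Def. 13.44 for
`𝓛 = 𝒪_X(D)`, `𝓕 = 𝒪_X`, in the sharpened form its printed proof yields:

* `CartierDivisor.IsAmple.exists_forall_le_isSection_affine` — **there is `n₀` such that for every
  `n ≥ n₀` every point of `X` lies in an affine `X_τ` with `τ ∈ Γ(X, 𝒪_X(n • D))`**; in particular
  `𝒪_X(n • D)` is generated by global sections and has nonzero sections for all `n ≥ n₀`
  (`IsAmple.exists_forall_le_isSection_ne_zero`).

The proof is the printed one (Görtz–Wedhorn I, p. 494, (iv) ⇒ (i), with Theorem 7.22): on an affine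
`X_s` contained in a chart `U i` the sheaf `𝒪_X(j • D)` is trivialised by `f i ^ {-j}`, and
`f i ^{-j} ⊗ s^{⊗ L}` extends to a global section of `𝒪_X((j + L d) • D)` for `L ≫ 0`. The extension
step is `CartierDivisor.exists_forall_le_isSection_pow_mul` (**Görtz–Wedhorn I, Thm. 7.22 (2)** for
`𝓛 = 𝒪_X(d • D)`, `𝓕 = 𝒪_X(j • D)`: a section of `𝓕` over `X_s` extends to a global section of
`𝓕 ⊗ 𝓛^{⊗L}` after multiplication by `s^{⊗L}`), reduced by quasi-compactness to the affine
statement `Γ(D(u), 𝒪_X) = Γ(U, 𝒪_X)[u⁻¹]` already in the tree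
(`RatFn.exists_pow_mul_eq_ofSection` of `Motives/CartierDivisorExtension`, restated pointwise as
`RatFn.exists_forall_isRegularAt_pow_mul`). The shrinking step `IsAmple`-chart ↦ basic open
`D(g) ⊆ X_s ∩ U i` is `CartierDivisor.exists_isSection_nonvanishing_subset` (the sets `X_{s^L g}`,
Görtz–Wedhorn I, Prop. 13.47 (iii)), and generation in all large degrees on such a chart is
`CartierDivisor.exists_forall_le_isSection_nonvanishing_eq`.

Also: multiplication by a nonzero section `t ∈ Γ(X, 𝒪_X(n • D))` is an injective `K`-linear map
`Γ(X, 𝒪_X(m • D)) → Γ(X, 𝒪_X((m + n) • D))` (`CartierDivisor.mulSection`), so `h⁰(m • D) ≤ h⁰((m + n) • D)`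
whenever the right-hand side is finite (`h0_le_h0_add_of_isSection`).

These are the inputs "nonzero sections and generation in all large degrees" of the cohomology-free
proof of Görtz–Wedhorn II, Prop. 23.83 (`CartierDivisor.asymptoticRiemannRoch_of_isAmple`,
`Motives/AbelianVarietyDegree`) pursued in this directory.

## References

* U. Görtz, T. Wedhorn, *Algebraic Geometry I: Schemes*, 2nd ed., Springer Spektrum (2020),
  doi:10.1007/978-3-658-30733-2: Thm. 7.22, p. 230; Def. 13.44, Remark 13.46, Prop. 13.47 and its
  proof, pp. 492–494. [GortzWedhorn2020]
-/

universe u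

open CategoryTheory AlgebraicGeometry TopologicalSpace Opposite
open Literature.AlgebraicGeometry.Motives.RatFn

noncomputable section

namespace Literature.AlgebraicGeometry.Motives

namespace RatFn

variable {X : Scheme.{u}} [IsIntegral X]

/-- **`Γ(D(u), 𝒪_X) = Γ(U, 𝒪_X)[u⁻¹]` in `K(X)`, pointwise form**: a rational function regular on the
basic open `X_u` of an affine open `U` becomes regular on all of `U` after multiplication by a power
of the rational function of `u`. A thin corollary of `RatFn.exists_pow_mul_eq_ofSection`
(`Motives/CartierDivisorExtension`; Görtz–Wedhorn I, Thm. 7.22 (2) for `X = U` affine), together with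
the degenerate case `ξ ∉ X_u`, where the rational function of `u` vanishes
(`RatFn.genericPoint_mem_basicOpen_iff`). [cite: GortzWedhorn2020, Thm. 7.22 (p. 230)] -/
theorem exists_forall_isRegularAt_pow_mul {U : X.Opens} (hU : IsAffineOpen U)
    (hξ : genericPoint X ∈ U) (u : Γ(X, U)) {h : X.functionField}
    (hh : ∀ y ∈ X.basicOpen u, IsRegularAt y h) :
    ∃ N : ℕ, ∀ y ∈ U, IsRegularAt y (ofSection hξ u ^ N * h) := by
  by_cases hu : genericPoint X ∈ X.basicOpen u
  · obtain ⟨N, a, e⟩ := exists_pow_mul_eq_ofSection hU u hu hh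
    refine ⟨N, fun y hy => ?_⟩
    rw [show ofSection hξ u = ofSection (X.basicOpen_le u hu) u from rfl, e]
    exact isRegularAt_ofSection hy a
  · have h0 : ofSection hξ u = 0 := by
      by_contra hne
      exact hu ((genericPoint_mem_basicOpen_iff hξ u).2 hne)
    refine ⟨1, fun y _ => ?_⟩
    rw [h0, pow_one, zero_mul]
    exact isRegularAt_zero

end RatFn

namespace CartierDivisor

variable {X : Scheme.{u}} [IsIntegral X] (D : CartierDivisor X)

/-- `s ∈ K(X)` is a **section of `𝒪_X(D)` over the subset `W`**: `f i · s` is regular at every point of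
`U i ∩ W` (Görtz–Wedhorn I, (11.9): `Γ(V, 𝒪_X(D)) = {f ∈ K(X) ; f_i f ∈ Γ(U_i ∩ V, 𝒪_X) ∀ i}`).
Generalises `CartierDivisor.IsSectionOver π U s` of `Motives/SeesawCohomologyBaseChange`
(`= IsSectionOn (π ⁻¹' U) s`). [cite: GortzWedhorn2020, Section (11.9) (p. 374)] -/
def IsSectionOn (W : Set X) (s : X.functionField) : Prop :=
  ∀ i (y : X), y ∈ D.U i → y ∈ W → IsRegularAt y (D.f i * s)

variable {D}

/-- A global section is a section over every subset. [folklore] -/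
theorem IsSection.isSectionOn {s : X.functionField} (hs : D.IsSection s) (W : Set X) :
    D.IsSectionOn W s := fun i y hy _ => hs i y hy

/-- A section over all of `X` is a global section. [folklore] -/
theorem IsSectionOn.isSection_of_univ {s : X.functionField} (hs : D.IsSectionOn Set.univ s) :
    D.IsSection s := fun i y hy => hs i y hy trivial

/-- The non-vanishing locus of a section of `𝒪(a • D)` lies in that of its powers... and conversely:
if `f i ^ a · s` is regular at `y` and `(f i ^ a s) · w` is a unit at `y` for some `w` regular at `y`,
then `y ∈ X_s`. [folklore] -/
theorem mem_nonvanishing_of_isUnitAt_mul {a : ℕ} {s w : X.functionField} (hs : (a • D).IsSection s)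
    {i : D.ι} {y : X} (hy : y ∈ D.U i) (hw : IsRegularAt y w)
    (hu : IsUnitAt y (D.f i ^ a * s * w)) : y ∈ (a • D).nonvanishing s :=
  ⟨i, hy, (hs i y hy).isUnitAt_of_mul hw hu⟩

/-! ### Extension of sections over `X_s` (Görtz–Wedhorn I, Thm. 7.22) -/

/-- **Extension of sections** (Görtz–Wedhorn I, Thm. 7.22 (2), for `𝓛 = 𝒪_X(a • D)`,
`𝓕 = 𝒪_X(j • D)` on a quasi-compact integral scheme): if `σ ∈ Γ(X, 𝒪_X(a • D))` and `β` is a section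
of `𝒪_X(j • D)` over the non-vanishing locus `X_σ`, then `σ^L β ∈ Γ(X, 𝒪_X((j + L a) • D))` for all
`L ≫ 0`. Proof: cover `X` by finitely many affine opens `V ⊆ U i`; on `V`, `X_σ ∩ V = D(u)` for the
section `u` with rational function `f i ^ a σ`, and `Γ(D(u)) = Γ(V)[u⁻¹]`
(`RatFn.exists_pow_mul_eq_ofSection`, via `RatFn.exists_forall_isRegularAt_pow_mul`).
[cite: GortzWedhorn2020, Thm. 7.22 (2) (p. 230)] -/
theorem exists_forall_le_isSection_pow_mul [CompactSpace X] {a j : ℕ} {σ β : X.functionField}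
    (hσ : (a • D).IsSection σ) (hβ : (j • D).IsSectionOn ((a • D).nonvanishing σ) β) :
    ∃ L₀ : ℕ, ∀ L, L₀ ≤ L → ((j + L * a) • D).IsSection (σ ^ L * β) := by
  classical
  -- local step at a point
  have step : ∀ y : X, ∃ V : X.Opens, y ∈ V ∧ ∃ N : ℕ, ∀ L, N ≤ L → ∀ (i' : D.ι) (z : X),
      z ∈ V → z ∈ D.U i' → IsRegularAt z (D.f i' ^ (j + L * a) * (σ ^ L * β)) := by
    intro y
    obtain ⟨i, hyi⟩ := D.covers y
    obtain ⟨_, ⟨V, hV, rfl⟩, hyV, hVU⟩ :=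
      X.isBasis_affineOpens.exists_subset_of_mem_open (hyi : y ∈ (D.U i : Set X)) (D.U i).isOpen
    have hξV : genericPoint X ∈ V := genericPoint_mem_of_mem hyV
    have hVU' : ∀ z ∈ V, z ∈ D.U i := fun z hz => hVU hz
    -- `u ∈ Γ(V)` with rational function `f i ^ a σ`
    obtain ⟨u, hu⟩ := exists_germ_eq_of_forall_isRegularAt hξV (h := D.f i ^ a * σ)
      (fun z hz => hσ i z (hVU' z hz))
    -- `f i ^ j β` is regular on `D(u) = X_σ ∩ V`
    have hβu : ∀ z ∈ X.basicOpen u, IsRegularAt z (D.f i ^ j * β) := by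
      intro z hz
      have hzV : z ∈ V := X.basicOpen_le u hz
      have hunit : IsUnitAt z (D.f i ^ a * σ) := by
        rw [← hu]; exact (isUnitAt_ofSection_iff hzV u).2 hz
      exact hβ i z (hVU' z hzV) ⟨i, hVU' z hzV, hunit⟩
    obtain ⟨N, hN⟩ := exists_forall_isRegularAt_pow_mul hV hξV u hβu
    rw [show ofSection hξV u = D.f i ^ a * σ from hu] at hN
    refine ⟨V, hyV, N, fun L hL i' z hzV hzi' => ?_⟩
    obtain ⟨L', rfl⟩ := Nat.exists_eq_add_of_le hL
    have hzi : z ∈ D.U i := hVU' z hzV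
    have hfi : D.f i ≠ 0 := D.f_ne_zero i
    have e : D.f i' ^ (j + (N + L') * a) * (σ ^ (N + L') * β) =
        (D.f i' / D.f i) ^ (j + (N + L') * a) *
          ((D.f i ^ a * σ) ^ L' * ((D.f i ^ a * σ) ^ N * (D.f i ^ j * β))) := by
      rw [div_pow, div_mul_eq_mul_div, eq_div_iff (pow_ne_zero _ hfi)]
      ring
    rw [e]
    exact ((D.isUnitAt_div i' i z hzi' hzi).pow _).isRegularAt.mul
      (((hσ i z hzi).pow L').mul (hN z hzV))
  choose V hyV N hN using step
  obtain ⟨t, ht⟩ := isCompact_univ.elim_finite_subcover (fun y : X => (V y : Set X))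
    (fun y => (V y).isOpen) (fun z _ => Set.mem_iUnion.2 ⟨z, hyV z⟩)
  refine ⟨t.sup N, fun L hL i' z hzi' => ?_⟩
  obtain ⟨y, hyt, hzy⟩ : ∃ y ∈ t, z ∈ (V y : Set X) := by
    simpa only [Set.mem_iUnion, exists_prop] using ht (Set.mem_univ z)
  exact hN y L ((Finset.le_sup hyt).trans hL) i' z hzy hzi'

/-! ### Shrinking affine non-vanishing loci to basic opens (Görtz–Wedhorn I, Prop. 13.47 (iii)) -/

/-- **Shrinking** (statement (iii) of Görtz–Wedhorn I, Prop. 13.47, proved here directly from (iv) via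
Thm. 7.22): if `X_s` is an
affine non-vanishing locus of `s ∈ Γ(X, 𝒪_X(a • D))`, `a ≥ 1`, and `W` is an open neighbourhood of
`x ∈ X_s`, there are `b ≥ 1` and `s' ∈ Γ(X, 𝒪_X(b • D))` (namely `s' = s^L g` for a basic open
`D(g) ⊆ X_s ∩ W` around `x`) with `x ∈ X_{s'} = D(g) ⊆ X_s ∩ W`; in particular `X_{s'}` is affine.
[cite: GortzWedhorn2020, Prop. 13.47 (p. 493)] -/
theorem exists_isSection_nonvanishing_subset [CompactSpace X] {a : ℕ} (ha : 0 < a)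
    {s : X.functionField} (hs : (a • D).IsSection s)
    (haff : IsAffineOpen ((a • D).nonvanishingOpens s)) {x : X} (hx : x ∈ (a • D).nonvanishing s)
    {W : X.Opens} (hxW : x ∈ W) :
    ∃ (b : ℕ) (s' : X.functionField), 0 < b ∧ (b • D).IsSection s' ∧ x ∈ (b • D).nonvanishing s' ∧
      (b • D).nonvanishing s' ⊆ (W : Set X) ∧ (b • D).nonvanishing s' ⊆ (a • D).nonvanishing s ∧
      IsAffineOpen ((b • D).nonvanishingOpens s') := by
  set V : X.Opens := (a • D).nonvanishingOpens s with hV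
  have hxV : x ∈ V := hx
  obtain ⟨g, hgW, hxg⟩ := haff.exists_basicOpen_le ⟨x, hxW⟩ hxV
  have hξV : genericPoint X ∈ V := genericPoint_mem_of_mem hxV
  set γ : X.functionField := X.presheaf.germ V (genericPoint X) hξV g with hγ
  -- `γ` is a section of `𝒪_X = 𝒪_X(0 • D)` over `X_s = V`
  have hγsec : (0 • D).IsSectionOn ((a • D).nonvanishing s) γ := by
    intro i z _ hz
    change IsRegularAt z (D.f i ^ 0 * γ)
    rw [pow_zero, one_mul]
    exact isRegularAt_ofSection hz g
  obtain ⟨L₀, hL₀⟩ := exists_forall_le_isSection_pow_mul hs hγsec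
  simp only [zero_add] at hL₀
  -- `s' = s ^ (L₀ + 1) γ`
  refine ⟨(L₀ + 1) * a, s ^ (L₀ + 1) * γ, Nat.mul_pos (Nat.succ_pos _) ha, hL₀ _ (Nat.le_succ _),
    ?_, ?_, ?_, ?_⟩
  · -- `x ∈ X_{s'}`
    obtain ⟨i, hxi, hux⟩ := hx
    refine ⟨i, hxi, ?_⟩
    change IsUnitAt x (D.f i ^ ((L₀ + 1) * a) * (s ^ (L₀ + 1) * γ))
    have e : D.f i ^ ((L₀ + 1) * a) * (s ^ (L₀ + 1) * γ) = (D.f i ^ a * s) ^ (L₀ + 1) * γ := by ring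
    rw [e]
    exact (hux.pow _).mul ((isUnitAt_ofSection_iff hxV g).2 hxg)
  · -- `X_{s'} ⊆ D(g) ⊆ W`
    rintro z ⟨i, hzi, huz⟩
    change IsUnitAt z (D.f i ^ ((L₀ + 1) * a) * (s ^ (L₀ + 1) * γ)) at huz
    have e : D.f i ^ ((L₀ + 1) * a) * (s ^ (L₀ + 1) * γ) =
        D.f i ^ a * s * (D.f i ^ (L₀ * a) * (s ^ L₀ * γ)) := by ring
    rw [e] at huz
    have hreg : IsRegularAt z (D.f i ^ (L₀ * a) * (s ^ L₀ * γ)) := hL₀ L₀ le_rfl i z hzi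
    have hzs : z ∈ (a • D).nonvanishing s := mem_nonvanishing_of_isUnitAt_mul hs hzi hreg huz
    -- now `γ` is regular at `z`, and a unit
    have hγz : IsRegularAt z γ := isRegularAt_ofSection hzs g
    have e' : D.f i ^ a * s * (D.f i ^ (L₀ * a) * (s ^ L₀ * γ)) = (D.f i ^ a * s) ^ (L₀ + 1) * γ := by
      ring
    rw [e'] at huz
    have hγu : IsUnitAt z γ := (((hs i z hzi).pow _)).isUnitAt_of_mul' hγz huz
    exact hgW ((isUnitAt_ofSection_iff hzs g).1 hγu)
  · -- `X_{s'} ⊆ X_s`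
    rintro z ⟨i, hzi, huz⟩
    change IsUnitAt z (D.f i ^ ((L₀ + 1) * a) * (s ^ (L₀ + 1) * γ)) at huz
    have e : D.f i ^ ((L₀ + 1) * a) * (s ^ (L₀ + 1) * γ) =
        D.f i ^ a * s * (D.f i ^ (L₀ * a) * (s ^ L₀ * γ)) := by ring
    rw [e] at huz
    exact mem_nonvanishing_of_isUnitAt_mul hs hzi (hL₀ L₀ le_rfl i z hzi) huz
  · -- `X_{s'} = D(g)` is affine
    suffices heq : (((L₀ + 1) * a) • D).nonvanishingOpens (s ^ (L₀ + 1) * γ) = X.basicOpen g by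
      rw [heq]; exact haff.basicOpen g
    ext z
    simp only [SetLike.mem_coe]
    constructor
    · rintro ⟨i, hzi, huz⟩
      change IsUnitAt z (D.f i ^ ((L₀ + 1) * a) * (s ^ (L₀ + 1) * γ)) at huz
      have e : D.f i ^ ((L₀ + 1) * a) * (s ^ (L₀ + 1) * γ) =
          D.f i ^ a * s * (D.f i ^ (L₀ * a) * (s ^ L₀ * γ)) := by ring
      rw [e] at huz
      have hreg : IsRegularAt z (D.f i ^ (L₀ * a) * (s ^ L₀ * γ)) := hL₀ L₀ le_rfl i z hzi
      have hzs : z ∈ (a • D).nonvanishing s := mem_nonvanishing_of_isUnitAt_mul hs hzi hreg huz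
      have hγz : IsRegularAt z γ := isRegularAt_ofSection hzs g
      have e' : D.f i ^ a * s * (D.f i ^ (L₀ * a) * (s ^ L₀ * γ)) =
          (D.f i ^ a * s) ^ (L₀ + 1) * γ := by ring
      rw [e'] at huz
      have hγu : IsUnitAt z γ := (((hs i z hzi).pow _)).isUnitAt_of_mul' hγz huz
      exact (isUnitAt_ofSection_iff hzs g).1 hγu
    · intro hz
      have hzV : z ∈ V := X.basicOpen_le g hz
      obtain ⟨i, hzi, huz⟩ := (id hzV : z ∈ (a • D).nonvanishing s)
      refine ⟨i, hzi, ?_⟩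
      change IsUnitAt z (D.f i ^ ((L₀ + 1) * a) * (s ^ (L₀ + 1) * γ))
      have e : D.f i ^ ((L₀ + 1) * a) * (s ^ (L₀ + 1) * γ) = (D.f i ^ a * s) ^ (L₀ + 1) * γ := by
        ring
      rw [e]
      exact (huz.pow _).mul ((isUnitAt_ofSection_iff hzV g).2 hz)

/-! ### Sections of all large degrees on an affine chart (Görtz–Wedhorn I, Prop. 13.47 (iv) ⇒ (i)) -/

/-- **Local generation in all large degrees** (Görtz–Wedhorn I, proof of Prop. 13.47 (iv) ⇒ (i),
p. 494, for `𝓕 = 𝒪_X(j • D)`, `0 ≤ j < b`): if `s' ∈ Γ(X, 𝒪_X(b • D))`, `b ≥ 1`, has non-vanishing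
locus `X_{s'} ⊆ U i`, then `𝒪_X(j • D)` is trivialised on `X_{s'}` by `f i ^{-j}`, and
`τ = f i^{-j} s'^L ∈ Γ(X, 𝒪_X((j + L b) • D))` for `L ≫ 0` (Thm. 7.22) has `X_τ = X_{s'}`. Hence there
is `n₀` such that for every `n ≥ n₀` some `τ ∈ Γ(X, 𝒪_X(n • D))` has `X_τ = X_{s'}`.
[cite: GortzWedhorn2020, Prop. 13.47, proof of (iv) ⇒ (i) (p. 494)] -/
theorem exists_forall_le_isSection_nonvanishing_eq [CompactSpace X] {b : ℕ} (hb : 0 < b)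
    {s' : X.functionField} (hs' : (b • D).IsSection s') {i : D.ι}
    (hsub : (b • D).nonvanishing s' ⊆ (D.U i : Set X)) :
    ∃ n₀ : ℕ, ∀ n, n₀ ≤ n → ∃ τ : X.functionField, (n • D).IsSection τ ∧
      (n • D).nonvanishing τ = (b • D).nonvanishing s' := by
  classical
  have hfi : D.f i ≠ 0 := D.f_ne_zero i
  -- `β j = f i ^{-j}` is a section of `𝒪(j • D)` over `X_{s'} ⊆ U i`
  have hβ : ∀ j : ℕ, (j • D).IsSectionOn ((b • D).nonvanishing s') ((D.f i ^ j)⁻¹) := by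
    intro j i' z hzi' hz
    change IsRegularAt z (D.f i' ^ j * (D.f i ^ j)⁻¹)
    rw [← div_eq_mul_inv, ← div_pow]
    exact ((D.isUnitAt_div i' i z hzi' (hsub hz)).pow j).isRegularAt
  choose L hL using fun j => exists_forall_le_isSection_pow_mul hs' (hβ j)
  -- uniform bound over `j < b`
  set Lmax : ℕ := (Finset.range b).sup L + 1 with hLmax
  refine ⟨b * Lmax, fun n hn => ?_⟩
  -- write `n = j + q b` with `j < b`, `q ≥ Lmax`
  set j := n % b with hj
  set q := n / b with hq
  have hjb : j < b := Nat.mod_lt n hb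
  have hn' : n = j + q * b := by rw [hj, hq, mul_comm]; exact (Nat.mod_add_div n b).symm
  have hqL : Lmax ≤ q := by
    rw [hq]
    exact (Nat.le_div_iff_mul_le hb).2 (by rw [mul_comm]; exact hn)
  have hLj : L j + 1 ≤ q := by
    have : L j ≤ (Finset.range b).sup L := Finset.le_sup (Finset.mem_range.2 hjb)
    omega
  obtain ⟨q', hq'⟩ := Nat.exists_eq_add_of_le hLj
  refine ⟨s' ^ q * (D.f i ^ j)⁻¹, hn' ▸ hL j q (by omega), ?_⟩
  rw [hn']
  ext z
  constructor
  · rintro ⟨i', hzi', huz⟩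
    change IsUnitAt z (D.f i' ^ (j + q * b) * (s' ^ q * (D.f i ^ j)⁻¹)) at huz
    rw [hq'] at huz
    have e : D.f i' ^ (j + (L j + 1 + q') * b) * (s' ^ (L j + 1 + q') * (D.f i ^ j)⁻¹) =
        D.f i' ^ b * s' * (D.f i' ^ (j + (L j + q') * b) * (s' ^ (L j + q') * (D.f i ^ j)⁻¹)) := by
      ring
    rw [e] at huz
    have hreg : IsRegularAt z (D.f i' ^ (j + (L j + q') * b) * (s' ^ (L j + q') * (D.f i ^ j)⁻¹)) :=
      hL j (L j + q') (Nat.le_add_right _ _) i' z hzi'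
    exact mem_nonvanishing_of_isUnitAt_mul hs' hzi' hreg huz
  · intro hz
    have hzi : z ∈ D.U i := hsub hz
    refine ⟨i, hzi, ?_⟩
    change IsUnitAt z (D.f i ^ (j + q * b) * (s' ^ q * (D.f i ^ j)⁻¹))
    have e : D.f i ^ (j + q * b) * (s' ^ q * (D.f i ^ j)⁻¹) = (D.f i ^ b * s') ^ q := by
      field_simp
      ring
    rw [e]
    exact (((b • D).mem_nonvanishing_iff (i := i) hzi).1 hz).pow q

/-! ### Eventual generation by sections with affine non-vanishing loci -/

/-- **Görtz–Wedhorn I, Prop. 13.47 (iv) ⇒ (i) (with Def. 13.44 and Thm. 7.22), for the powers of an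
ample divisor**: if `D` is ample then there is `n₀` such that for every `n ≥ n₀` every point of `X`
lies in an *affine* non-vanishing locus `X_τ`, `τ ∈ Γ(X, 𝒪_X(n • D))` — i.e. `𝒪_X(n • D)` is generated
by (finitely many) global sections with affine `X_τ` for all `n ≥ n₀` (Def. 13.44 for `𝓕 = 𝒪_X`, in
the strong form of the printed proof: the extended sections `g_{ij} ⊗ f_i^{⊗m}` have
`X_{g_{ij} ⊗ f_i^{⊗ m}} = (X_{f_i})_{g_{ij}}` affine). [cite: GortzWedhorn2020, Prop. 13.47 (iv) ⇒ (i) (p. 494) with Def. 13.44] -/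
theorem IsAmple.exists_forall_le_isSection_affine (hD : D.IsAmple) :
    ∃ n₀ : ℕ, ∀ n, n₀ ≤ n → ∀ x : X, ∃ τ : X.functionField, (n • D).IsSection τ ∧
      x ∈ (n • D).nonvanishing τ ∧ IsAffineOpen ((n • D).nonvanishingOpens τ) := by
  classical
  obtain ⟨hc, -, a, ha, H⟩ := hD
  -- at each point: an affine `X_{s'} ∋ x` inside a chart, and sections of all large degrees
  have step : ∀ x : X, ∃ (b : ℕ) (s' : X.functionField), (b • D).IsSection s' ∧
      x ∈ (b • D).nonvanishing s' ∧ IsAffineOpen ((b • D).nonvanishingOpens s') ∧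
      ∃ n₀ : ℕ, ∀ n, n₀ ≤ n → ∃ τ : X.functionField, (n • D).IsSection τ ∧
        (n • D).nonvanishing τ = (b • D).nonvanishing s' := by
    intro x
    obtain ⟨s, hs, hxs, haff⟩ := H x
    obtain ⟨i, hxi⟩ := D.covers x
    obtain ⟨b, s', hb, hs', hxs', hW, -, haff'⟩ :=
      exists_isSection_nonvanishing_subset ha hs haff hxs (W := D.U i) hxi
    exact ⟨b, s', hs', hxs', haff', exists_forall_le_isSection_nonvanishing_eq hb hs' hW⟩
  choose b s' hs' hxs' haff' n₀ hn₀ using step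
  obtain ⟨t, ht⟩ := isCompact_univ.elim_finite_subcover (fun x : X => (b x • D).nonvanishing (s' x))
    (fun x => (b x • D).isOpen_nonvanishing (s' x)) (fun z _ => Set.mem_iUnion.2 ⟨z, hxs' z⟩)
  refine ⟨t.sup n₀, fun n hn z => ?_⟩
  obtain ⟨x, hxt, hzx⟩ : ∃ x ∈ t, z ∈ (b x • D).nonvanishing (s' x) := by
    simpa only [Set.mem_iUnion, exists_prop] using ht (Set.mem_univ z)
  obtain ⟨τ, hτ, hτeq⟩ := hn₀ x n ((Finset.le_sup hxt).trans hn)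
  refine ⟨τ, hτ, hτeq ▸ hzx, ?_⟩
  have : (n • D).nonvanishingOpens τ = (b x • D).nonvanishingOpens (s' x) := Opens.ext hτeq
  rw [this]
  exact haff' x

/-- **An ample divisor has nonzero sections in all large degrees**: `Γ(X, 𝒪_X(n • D)) ≠ 0` for all
`n ≥ n₀` (Görtz–Wedhorn I, Def. 13.44 / Prop. 13.47: `𝒪_X(n • D)` is generated by global sections for
`n ≫ 0`, and `X ≠ ∅`). [cite: GortzWedhorn2020, Prop. 13.47 (iv) ⇒ (i) (p. 494) with Def. 13.44] -/
theorem IsAmple.exists_forall_le_isSection_ne_zero (hD : D.IsAmple) :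
    ∃ n₀ : ℕ, ∀ n, n₀ ≤ n → ∃ s : X.functionField, (n • D).IsSection s ∧ s ≠ 0 := by
  obtain ⟨n₀, h⟩ := hD.exists_forall_le_isSection_affine
  refine ⟨n₀, fun n hn => ?_⟩
  obtain ⟨τ, hτ, ⟨i, hi, hu⟩, -⟩ := h n hn (genericPoint X)
  refine ⟨τ, hτ, fun h0 => ?_⟩
  rw [h0, mul_zero] at hu
  exact hu.ne_zero rfl

/-! ### Multiplication by a section -/

section OverField

variable (K : Type u) [Field K] [X.Over (Spec (.of K))]

/-- **Multiplication by a section** `t ∈ Γ(X, 𝒪_X(n • D))`: the `K`-linear map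
`Γ(X, 𝒪_X(m • D)) → Γ(X, 𝒪_X((m + n) • D))`, `s ↦ s t` (the graded ring structure on
`⊕ₙ Γ(X, 𝒪_X(n • D))`, Görtz–Wedhorn I, (13.11)). [folklore] -/
def mulSection {m n : ℕ} {t : X.functionField} (ht : (n • D).IsSection t) :
    (m • D).sections K →ₗ[K] ((m + n) • D).sections K where
  toFun s := ⟨(s : X.functionField) * t, IsSection.mul _ s.2 ht⟩
  map_add' s s' := by ext; simp [add_mul]
  map_smul' c s := by ext; simp [Algebra.smul_def, mul_assoc]

/-- `mulSection` is `s ↦ s t` on the underlying rational functions. [folklore] -/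
@[simp]
theorem mulSection_apply {m n : ℕ} {t : X.functionField} (ht : (n • D).IsSection t)
    (s : (m • D).sections K) : (mulSection K ht s : X.functionField) = s * t := rfl

/-- Multiplication by a nonzero section is injective (`K(X)` is a field). [folklore] -/
theorem mulSection_injective {m n : ℕ} {t : X.functionField} (ht : (n • D).IsSection t) (ht0 : t ≠ 0) :
    Function.Injective (mulSection K (m := m) ht) := by
  intro s s' h
  apply Subtype.ext
  have := congrArg Subtype.val h
  simpa [mul_eq_mul_right_iff, ht0] using this

/-- **`h⁰(m • D) ≤ h⁰((m + n) • D)` if `𝒪_X(n • D)` has a nonzero section** and the right-hand side is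
finite. [folklore] -/
theorem h0_le_h0_add_of_isSection {m n : ℕ} {t : X.functionField} (ht : (n • D).IsSection t)
    (ht0 : t ≠ 0) [FiniteDimensional K (((m + n) • D).sections K)] :
    (m • D).h0 K ≤ ((m + n) • D).h0 K :=
  LinearMap.finrank_le_finrank_of_injective (mulSection_injective K ht ht0)

/-- If `𝒪_X(n • D)` has a nonzero section and `Γ(X, 𝒪_X((m + n) • D))` is finite-dimensional, so is
`Γ(X, 𝒪_X(m • D))`. [folklore] -/
theorem finiteDimensional_of_isSection {m n : ℕ} {t : X.functionField} (ht : (n • D).IsSection t)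
    (ht0 : t ≠ 0) [FiniteDimensional K (((m + n) • D).sections K)] :
    FiniteDimensional K ((m • D).sections K) :=
  Module.Finite.of_injective _ (mulSection_injective K ht ht0)

end OverField

end CartierDivisor

end Literature.AlgebraicGeometry.Motives

end
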